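import Literature.ComputerArithmetic.RumpOgitaOishi2008.AccSum

/-!
# Rump–Ogita–Oishi, *Accurate floating-point summation part II*: §5 K-fold faithful rounding
# (Lemma 5.1, Definition 5.2, Lemma 5.3, Definition 5.4, Lemma 5.5, Proposition 5.6)

HONEST FRAMING (ENGINES group, unit `eng-quad-4`, kernels lane of the `certquad` engine — shared
numerical engines serving client cells; rigour lives in the verifiers; every published number
belongs to a client cell's ledger, not to the engines group): §5 of Part II is typed and proved at FORMAT
LEVEL, in the model of the lane's Part I files (`RumpOgitaOishi2008.ExtractVector`, `.AccSum`) and of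
`RumpOgitaOishi2009.AccSign` (§§3–4 of Part II) — the tree's binary floating-point numbers
`JeannerodRump2018.IsFloat p emin` (precision `p`, gradual underflow from `emin`, NO overflow); no rounding map
occurs in this section, which is about sequences of floats approximating a real number. This file carries the
notions Part II introduces for results of K-fold accuracy: LEMMA 5.1 (how far a faithful rounding `f ∈ □(r)` is
from `r`, in units of `ufp`), DEFINITION 5.2 (non-overlapping sequences) with LEMMA 5.3, DEFINITION 5.4 ((k-fold)
faithful / strongly faithful rounding of `s` by a sequence `f₁, …, f_k`), LEMMA 5.5 (consecutive members overlap
in at most one bit; where members in the underflow range can sit) and PROPOSITION 5.6 (the accuracy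
`|s − Σ fν| < 2epsᵏ·ufp(s)` resp. `< eta`, and the example of a faithful but overlapping pair) — all PROVED, two
printed clauses of Lemma 5.5 CORRECTED (NOTES (b), (c)) with kernel-checked counterexamples to the printed
wording. No hardware, timing, flop-count or IEEE-format claims: `p` and `emin` are parameters.

Source read at the page: [RumpOgitaOishi2009] S. M. Rump, T. Ogita, S. Oishi, *Accurate floating-point
summation part II: sign, K-fold faithful and rounding to nearest*, SIAM J. Sci. Comput. 31(2) (2008/09)
1269–1302, doi:10.1137/07068816X; read in the authors' version (30 pp.; its page numbers are used): p. 2 (§2,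
eq. (2.1): `f ∈ U ⇔ 0 ≤ |f| ≤ ½eps⁻¹eta`, "for `f ∈ U`, `f ± eta` are the floating-point neighbors of `f`"), p. 9
(§5 introduction, eq. (5.1), Lemma 5.1 with eqs. (5.2)–(5.3) and its proof, the Remark on `s ∈ etaℤ`,
Definition 5.2, eq. (5.4), the Remark on zeros), p. 10 (Lemma 5.3, eqs. (5.5)–(5.8) and proof, the Remark on
subsequences, eq. (5.9), Definition 5.4, eq. (5.10), Lemma 5.5, eq. (5.11)), p. 11 (proof of Lemma 5.5 with
eq. (5.12), Proposition 5.6, eqs. (5.13)–(5.14) and proof, the overlapping example, the comparison with `SumK`).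

DICTIONARY (source ↦ here; carrier `ℚ`; the dictionaries of `ExtractVector` and `AccSum` — `F ↦ IsFloat p emin`,
`eps ↦ unitRoundoff p = 2^-p`, `eta ↦ 2^emin`, `f ∈ U ↦ |f| ≤ 2^(emin+p-1)` (`½eps⁻¹eta`, eq. (2.1)),
`f ∉ U ↦ 2^(emin+p-1) < |f|`, `ufp ↦ RumpOgitaOishi2008.ufp`, `gℤ ↦ OnGrid g` (`etaℤ ↦ OnGrid (2^emin)`),
`pred`/`succ ↦ IsPred`/`IsSucc`, and Definition 2.2 = Part I Definition 2.3, `f ∈ □(r) ↦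
RumpOgitaOishi2008.IsFaithfulRounding p emin f r` (which includes `f ∈ F`) — continue).
* a sequence `f₁, …, f_k` ↦ `l : List ℚ` with `f₁ = l[0] = l.head`, `f_k = l.getLast`, `k = l.length`;
  `Σ_{ν<i} fν` ↦ `(l.take i).sum` in front of the member `l[i]`; `Δᵢ = s − Σ_{ν≤i} fν` ↦ `s − (l.take i).sum`;
  `Σ fν ↦ l.sum`.
* Definition 5.2: (5.4) for one pair `(fᵢ, fᵢ₊₁)` ↦ `NonOverlapStep p fᵢ fᵢ₊₁`; "non-overlapping" ↦
  `NonOverlapping p l` (the chain of (5.4) along `l`, `List.IsChain`; the printed indexed form is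
  `nonOverlapping_iff_getElem`).
* Definition 5.4 ↦ `IsKFoldFaithful p emin l s` (recursive: `f₁ ∈ □(s)` and the tail is a faithful rounding of
  `s − f₁`; the printed indexed form (5.10) is `isKFoldFaithful_iff_getElem`, the form (5.12) is
  `IsKFoldFaithful.pred_lt_lt_succ`); "strongly faithful" ↦ `IsStronglyFaithful p emin l s`
  (`IsKFoldFaithful ∧ NonOverlapping`).

Typed and PROVED (all sorry-free; `[cite: …]` locators on every declaration):

* (5.1) — `isFaithfulRounding_neg` (`□` is odd), `isFaithfulRounding_self` (`f ∈ □(f)`);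
  `isFloat_add_two_u_ufp_of_threshold_le` (`f ± 2eps·ufp(f) ∈ F` for `|f| ≥ ½eps⁻¹eta`, the grid fact used in
  the proof of Lemma 5.5).
* LEMMA 5.1 — `faithful_abs_sub_lt_two_u_ufp` ((5.2), both inequalities; the printed "`f > 0`" case is
  `faithful_abs_sub_lt_two_u_ufp_arg_of_pos`), `faithful_abs_sub_lt_eta` ((5.3)), `faithful_eq_of_mem_U_of_onGrid`
  (the Remark: `r ∈ etaℤ`, `f ∈ U ⟹ r = f`); `ufp_le_u_mul_ufp_of_abs_lt` and `faithful_ufp_sub_le` ((5.14), one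
  step).
* DEFINITION 5.2 / LEMMA 5.3 — `NonOverlapStep`, `NonOverlapping`, `nonOverlapping_iff_getElem` ((5.4) as
  printed), `nonOverlapping_nil` / `_singleton` / `_cons_cons`, `NonOverlapping.of_cons`; the Remark:
  `nonOverlapStep_zero_right`, `nonOverlapping_replicate_zero` ("a sequence of zeros"),
  `NonOverlapping.append_replicate_zero` ("trailing zeros"), `NonOverlapping.eq_zero_of_head`,
  `NonOverlapStep.eq_zero`; (5.7) `NonOverlapStep.ufp_le`; `NonOverlapStep.trans` (+ the `Trans` instance) and
  the subsequence Remark `NonOverlapping.sublist`; (5.5) `NonOverlapping.ufp_getElem_le` (member-wise) and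
  `NonOverlapping.ufp_getLast_le` (as printed); (5.8) `NonOverlapStep.abs_add_two_ufp_le`; (5.6)
  `NonOverlapping.abs_sum_lt_two_ufp` (and `…_head`).
* DEFINITION 5.4 — `IsKFoldFaithful`, `IsStronglyFaithful` (+ projections), `isKFoldFaithful_nil` / `_cons`,
  `isKFoldFaithful_iff_getElem` ((5.10)), `IsKFoldFaithful.isFloat` / `.take` / `.drop` / `.pair`,
  `IsKFoldFaithful.pred_lt_lt_succ` ((5.12)), `IsKFoldFaithful.eq_zero_of_zero` (a faithful rounding of `0` is
  zero).
* LEMMA 5.5 — `abs_le_two_u_ufp_of_faithful_pair` and `IsKFoldFaithful.abs_getElem_succ_le` ((5.11));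
  `ufp_eq_abs_of_abs_eq_two_u_ufp` (the equality clause, in the direction that holds);
  `abs_le_eta_of_faithful_pair` (a member in `U` is followed by a member of magnitude `≤ eta`);
  `IsKFoldFaithful.threshold_lt_abs_of_eta_lt_abs` ("`|f_m| > 2eta` implies `fᵢ ∉ U`, `i < m`", from the weaker
  `|f_m| > eta`); `IsKFoldFaithful.getElem_eq_zero_of_abs_le_threshold` ("`|f_m| < ½eps⁻¹eta` implies `fᵢ = 0`,
  `i > m`", for `s ∈ etaℤ`); the counterexamples `lemma_5_5_iff_converse_fails`, `lemma_5_5_last_clause_needs_grid`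
  (NOTES (b), (c); `exists_int_eq_of_isFloat_three_zero`).
* PROPOSITION 5.6 — `IsKFoldFaithful.threshold_lt_abs_of_getLast` ("`f_k ∉ U` implies `fᵢ ∉ U`"),
  `IsKFoldFaithful.ufp_sub_sum_le` / `_head` ((5.14) iterated), `IsKFoldFaithful.abs_sub_sum_lt_of_not_mem_U`
  ((5.13), `f_k ∉ U`, both bounds), `IsKFoldFaithful.abs_sub_sum_lt_rel` ((5.9), `< 2epsᵏ|s|`),
  `IsKFoldFaithful.abs_sub_sum_lt_eta` ((5.13), `f_k ∈ U`), `IsKFoldFaithful.sum_eq_of_onGrid` (`s ∈ etaℤ`,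
  `f_k ∈ U` ⟹ `Σ fν = s`, the form §6 uses); "Moreover … may be overlapping":
  `faithful_not_nonOverlapping_example` (`f₁ = 1 − eps`, `f₂ = eps`, `s = 1 − eps³`; every `p ≥ 1`, `emin ≤ −p`);
  `u_le_half`, `u_eq_two_zpow_neg`.

NOTES. (a) (5.6) carries the hypothesis `f₁ ≠ 0`: the printed strict inequality `|Σ fν| < 2ufp(f₁)` reads
`0 < 0` for a sequence of zeros, which Definition 5.2's Remark admits; since a zero member is followed by zeros
only (`NonOverlapping.eq_zero_of_head`), `f₁ ≠ 0` is exactly the non-degenerate case (the source's "omit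
trailing zeros and assume `f_k ≠ 0`"). (5.8) is proved for every `f ∈ F` WITHOUT the source's case distinction
`f ∈ U` / `f ∉ U`: the largest float below `2ufp(f)` is at most `2ufp(f) − 2eps·ufp(f)` in either case
(`BoldoJeannerodMelquiondMuller2023.abs_le_sub_of_abs_lt_two_zpow`).
(b) LEMMA 5.5, (5.11) "with equality if and only if `ufp(fᵢ) = |fᵢ|`": the direction "equality ⟹ `fᵢ` is a
power of 2" holds (for any pair, `ufp_eq_abs_of_abs_eq_two_u_ufp`) and is the content of "overlap in at most
one bit"; the direction "`ufp(fᵢ) = |fᵢ|` ⟹ equality" is FALSE as printed — `lemma_5_5_iff_converse_fails`: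
`p = 3`, `emin = 0`, `(f₁, f₂) = (16, 1)` is a faithful rounding of `s = 17` with `|f₁| ≥ ½eps⁻¹eta = 4`, `f₂ = 1`
a power of 2, and `|f₂| = 1 < 4 = 2eps·ufp(f₁)`.
(c) LEMMA 5.5, last clause "`|f_m| < ½eps⁻¹eta` implies `fᵢ = 0` for `m < i ≤ k`" is FALSE for a general real
`s` — `lemma_5_5_last_clause_needs_grid`: `p = 3`, `emin = 0`, `(1, 1)` is a faithful rounding of `s = 3/2` with
`|f₁| = 1 < 4 = ½eps⁻¹eta` and `f₂ ≠ 0`. It HOLDS for `s ∈ etaℤ`, the source's declared main application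
(`s = Σ pᵢ`, Remark after Lemma 5.1), even from `|f_m| ≤ ½eps⁻¹eta`
(`IsKFoldFaithful.getElem_eq_zero_of_abs_le_threshold`). What holds for every real `s` is the one-step fact
`abs_le_eta_of_faithful_pair` (`fᵢ₋₁ ∈ U ⟹ |fᵢ| ≤ eta`), from which the clause "`|f_m| > 2eta` implies `fᵢ ∉ U`
for `i < m`" follows from the WEAKER hypothesis `|f_m| > eta` (`IsKFoldFaithful.threshold_lt_abs_of_eta_lt_abs`),
and so does Proposition 5.6's "`f_k ∉ U` implies `fᵢ ∉ U` for `1 ≤ i ≤ k`" for every `p ≥ 1`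
(`IsKFoldFaithful.threshold_lt_abs_of_getLast`; for `p = 1`, `½eps⁻¹eta = eta`, so the printed route through
"`|f_k| > 2eta`" would miss `eta < |f_k| ≤ 2eta`).
(d) Proposition 5.6's example is proved for every precision `p ≥ 1` and every `emin ≤ −p` (so that
`f₂ = eps ∈ F`); the printed `pred(f₂) = eps − eps²` presumes `emin ≤ −2p`, but `f₂ ∈ □(s − f₁)` holds regardless
(every float below `eps` is `≤ eps − eps²`). Membership `fᵢ ∈ F` is part of `□`, hence of `IsKFoldFaithful`; it is
NOT part of `NonOverlapping` (Definition 5.2 is a condition on magnitudes) and enters (5.6)/(5.8) as a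
hypothesis.
(e) NOT typed here: the §5 introduction's survey of multiple-precision / staggered-correction techniques
(refs. [2, 3, 6, 7, 14, 19, 20, 21, 24] of the source), the comparison with `SumK` of ref. [18] after
Proposition 5.6, and §§6–9 of Part II (Algorithms 6.1–6.4 `TransformK` / `AccSumK` with Lemmas 6.1, 6.3,
Proposition 6.5 and the Appendix proof of (6.5); §7 `NearSum`; §8 `AccSumHugeN`; §9 timings) — the subject of
later files.
-/

namespace Literature.ComputerArithmetic.RumpOgitaOishi2009

open Literature.ComputerArithmetic.JeannerodRump2018
open Literature.ComputerArithmetic.BoldoJeannerodMelquiondMuller2023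
open Literature.ComputerArithmetic.JoldesMullerPopescu2017 (isFloat_two_zpow two_zpow_emin_le_abs)
open Literature.ComputerArithmetic.RumpOgitaOishi2008

variable {p : ℕ} {emin : ℤ}

/-! ### §5, eq. (5.1) and Lemma 5.1: properties of the ordinary faithful rounding `f ∈ □(r)` -/

/-- Symmetry of `□`: `f ∈ □(r) ⟹ −f ∈ □(−r)` ("without loss of generality `f > 0`", proof of Lemma 5.1;
"the case `fᵢ < 0` is treated similarly", proof of Lemma 5.5). [cite: RumpOgitaOishi2009, eq. (5.1)] -/
theorem isFaithfulRounding_neg {f r : ℚ} (h : IsFaithfulRounding p emin f r) :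
    IsFaithfulRounding p emin (-f) (-r) := by
  refine ⟨h.1.neg, fun g hg hgf => ?_, fun g hg hfg => ?_⟩
  · have := h.2.2 (-g) hg.neg (by linarith)
    linarith
  · have := h.2.1 (-g) hg.neg (by linarith)
    linarith

/-- `f ∈ F ⟹ f ∈ □(f)` (`pred(f) < f < succ(f)`, eq. (5.1)). [cite: RumpOgitaOishi2009, eq. (5.1)] -/
theorem isFaithfulRounding_self {f : ℚ} (hf : IsFloat p emin f) : IsFaithfulRounding p emin f f :=
  ⟨hf, fun _ _ h => h, fun _ _ h => h⟩

/-- The grid at and above the underflow threshold: for `f ∈ F` with `|f| ≥ ½eps⁻¹eta` the numbers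
`f − 2eps·ufp(f)` and `f + 2eps·ufp(f)` are in `F` (Part I, Lemma 2.2, typed there for `|f| > ½eps⁻¹eta` as
`RumpOgitaOishi2008.isFloat_add_two_u_ufp_of_not_mem_U`; at `|f| = ½eps⁻¹eta`, `2eps·ufp(f) = eta`). This is
"`succ(fᵢ₋₁) − fᵢ₋₁ ≤ 2eps·ufp(fᵢ₋₁)`, where the last inequality follows by the assumption
`|fᵢ₋₁| ≥ ½eps⁻¹eta`" in the proof of Lemma 5.5. [cite: RumpOgitaOishi2009, Lemma 5.5 (proof)] -/
theorem isFloat_add_two_u_ufp_of_threshold_le (hp : 1 ≤ p) {f : ℚ} (hf : IsFloat p emin f)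
    (hU : (2 : ℚ) ^ (emin + p - 1) ≤ |f|) (s : ℤ) (hs : |s| ≤ 1) :
    IsFloat p emin (f + s * (2 * unitRoundoff p * ufp f)) := by
  have hf0 : f ≠ 0 := by
    rintro rfl
    rw [abs_zero] at hU
    exact absurd hU (not_le.mpr (two_zpow_pos _))
  set E : ℤ := Int.log 2 |f| with hE
  have hEf : (2 : ℚ) ^ E ≤ |f| := zpow_log_le_abs hf0
  have hfE : |f| < (2 : ℚ) ^ (E + 1) := abs_lt_zpow_log_succ f
  have hufp : ufp f = (2 : ℚ) ^ E := ufp_of_ne_zero hf0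
  have hgrid : 2 * unitRoundoff p * ufp f = (2 : ℚ) ^ (E - p + 1) := by
    rw [hufp, two_mul_u_mul_two_zpow]
  have hElow : emin ≤ E - p + 1 := by
    by_contra hlt
    rw [not_le] at hlt
    have : (2 : ℚ) ^ (E + 1) ≤ (2 : ℚ) ^ (emin + p - 1) :=
      zpow_le_zpow_right₀ (by norm_num) (by omega)
    linarith
  have hg : OnGrid ((2 : ℚ) ^ (E - p + 1)) (f + s * (2 * unitRoundoff p * ufp f)) := by
    rw [hgrid]
    exact (onGrid_of_isFloat_of_le_abs hf hEf).add ((onGrid_self _).int_mul s)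
  refine isFloat_of_onGrid_two_zpow hp hg ?_ hElow
  have h1 : |f| ≤ (2 : ℚ) ^ (E + 1) - (2 : ℚ) ^ (E + 1 - p) := abs_le_sub_of_abs_lt_two_zpow hp hf hfE
  have h2 : |(s : ℚ) * (2 * unitRoundoff p * ufp f)| ≤ (2 : ℚ) ^ (E - p + 1) := by
    rw [hgrid, abs_mul, abs_of_pos (two_zpow_pos _)]
    have hs' : |(s : ℚ)| ≤ 1 := by rw [← Int.cast_abs]; exact_mod_cast hs
    calc |(s : ℚ)| * (2 : ℚ) ^ (E - p + 1) ≤ 1 * (2 : ℚ) ^ (E - p + 1) :=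
        mul_le_mul_of_nonneg_right hs' (two_zpow_pos _).le
      _ = (2 : ℚ) ^ (E - p + 1) := one_mul _
  have h3 : (2 : ℚ) ^ p * (2 : ℚ) ^ (E - p + 1) = (2 : ℚ) ^ (E + 1) := by
    rw [← zpow_natCast, ← zpow_add₀ (by norm_num : (2 : ℚ) ≠ 0)]
    congr 1
    omega
  have h4 : (2 : ℚ) ^ (E + 1 - p) = (2 : ℚ) ^ (E - p + 1) := by
    congr 1
    omega
  calc |f + s * (2 * unitRoundoff p * ufp f)| ≤ |f| + |(s : ℚ) * (2 * unitRoundoff p * ufp f)| :=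
      abs_add_le _ _
    _ ≤ ((2 : ℚ) ^ (E + 1) - (2 : ℚ) ^ (E + 1 - p)) + (2 : ℚ) ^ (E - p + 1) := add_le_add h1 h2
    _ = (2 : ℚ) ^ p * (2 : ℚ) ^ (E - p + 1) := by rw [h3, h4]; ring

/-- **LEMMA 5.1, eq. (5.3).** `f ∈ U` (`|f| ≤ ½eps⁻¹eta`) and `f ∈ □(r)` ⟹ `|r − f| < eta` ("`f ± eta` are
the neighbors of `f`"). [cite: RumpOgitaOishi2009, Lemma 5.1 eq. (5.3)] -/
theorem faithful_abs_sub_lt_eta (hp : 1 ≤ p) {f r : ℚ} (h : IsFaithfulRounding p emin f r)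
    (hU : |f| ≤ (2 : ℚ) ^ (emin + p - 1)) : |r - f| < (2 : ℚ) ^ emin := by
  obtain ⟨hpred, hsucc⟩ := isPred_sub_eta_and_isSucc_add_eta hp h.1 hU
  have h1 := h.2.1 _ hpred.1 hpred.2.1
  have h2 := h.2.2 _ hsucc.1 hsucc.2.1
  rw [abs_sub_lt_iff]
  constructor <;> linarith

/-- "Lemma 5.1 is formulated for general `r ∈ ℝ`. For our main application, the approximation of the sum
`s = Σ pᵢ` of floating-point numbers, … `s ∈ etaℤ`. Thus (5.3) reads in this case `f ∈ U ⇒ r = f`."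
[cite: RumpOgitaOishi2009, Lemma 5.1 (Remark, r ∈ etaℤ)] -/
theorem faithful_eq_of_mem_U_of_onGrid (hp : 1 ≤ p) {f r : ℚ} (h : IsFaithfulRounding p emin f r)
    (hU : |f| ≤ (2 : ℚ) ^ (emin + p - 1)) (hr : OnGrid ((2 : ℚ) ^ emin) r) : f = r := by
  have hlt := faithful_abs_sub_lt_eta hp h hU
  have hg : OnGrid ((2 : ℚ) ^ emin) (r - f) := hr.sub (onGrid_eta_of_isFloat h.1)
  by_contra hne
  have := two_zpow_le_abs_of_onGrid hg (sub_ne_zero.mpr (Ne.symm hne))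
  linarith

/-- (5.2), the inequality `|r − f| < 2eps·ufp(r)`, in the printed "without loss of generality `f > 0`" case:
for `f` not a power of 2, or `f ≤ r`, one has `ufp(f) ≤ ufp(r)`; for `f = 2ᴱ` and
`(1 − eps)f = pred(f) < r < f`, `|r − f| < eps·f = 2eps·ufp(r)`.
[cite: RumpOgitaOishi2009, Lemma 5.1 eq. (5.2) (proof)] -/
theorem faithful_abs_sub_lt_two_u_ufp_arg_of_pos (hp : 1 ≤ p) {f r : ℚ}
    (h : IsFaithfulRounding p emin f r) (hU : (2 : ℚ) ^ (emin + p - 1) < |f|) (hf : 0 < f) :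
    |r - f| < 2 * unitRoundoff p * ufp r := by
  have hf0 : f ≠ 0 := hf.ne'
  set E : ℤ := Int.log 2 |f| with hE
  have hEf : (2 : ℚ) ^ E ≤ |f| := zpow_log_le_abs hf0
  have hfE : |f| < (2 : ℚ) ^ (E + 1) := abs_lt_zpow_log_succ f
  have hufp : ufp f = (2 : ℚ) ^ E := ufp_of_ne_zero hf0
  have hupos : 0 < unitRoundoff p := u_pos
  -- `f − 2eps·ufp(f) ≤ pred(f)` and `succ(f) ≤ f + 2eps·ufp(f)` (Part I, Lemma 2.2) bound `r`:
  have hm := isFloat_add_two_u_ufp_of_not_mem_U hp h.1 hU (-1) (by simp)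
  have hp' := isFloat_add_two_u_ufp_of_not_mem_U hp h.1 hU 1 (by simp)
  simp only [Int.cast_neg, Int.cast_one, neg_mul, one_mul] at hm hp'
  have hpos : 0 < 2 * unitRoundoff p * ufp f := by
    have := ufp_pos hf0
    positivity
  have h1 := h.2.1 _ hm (by linarith)
  have h2 := h.2.2 _ hp' (by linarith)
  rcases le_or_gt ((2 : ℚ) ^ E) |r| with hr | hr
  · -- `ufp(f) ≤ ufp(r)`
    have hle : ufp f ≤ ufp r := by
      rw [hufp]
      exact two_zpow_le_ufp hr
    have h3 : |r - f| < 2 * unitRoundoff p * ufp f := by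
      rw [abs_sub_lt_iff]
      constructor <;> linarith
    calc |r - f| < 2 * unitRoundoff p * ufp f := h3
      _ ≤ 2 * unitRoundoff p * ufp r := by nlinarith
  · -- `|r| < ufp(f) ≤ f`: then `f = 2ᴱ` is a power of 2 and `pred(f) = f − eps·f < r < f`
    rw [abs_of_pos hf] at hEf hfE hU
    have hEmin : emin ≤ E := by
      by_contra hlt
      rw [not_le] at hlt
      have : (2 : ℚ) ^ (E + 1) ≤ (2 : ℚ) ^ (emin + p - 1) := zpow_le_zpow_right₀ (by norm_num) (by omega)
      linarith
    have hrE : r < (2 : ℚ) ^ E := (le_abs_self r).trans_lt hr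
    have hfeq : f = (2 : ℚ) ^ E := by
      by_contra hne
      have hlt : (2 : ℚ) ^ E < f := lt_of_le_of_ne hEf (Ne.symm hne)
      have := h.2.1 _ (isFloat_two_zpow hp hEmin) hlt
      linarith
    have hEp : emin + p ≤ E := by
      by_contra hlt
      rw [not_le] at hlt
      have : (2 : ℚ) ^ E ≤ (2 : ℚ) ^ (emin + p - 1) := zpow_le_zpow_right₀ (by norm_num) (by omega)
      linarith
    -- `pred(f) = 2ᴱ − 2ᴱ⁻ᵖ = (2ᵖ − 1)·2ᴱ⁻ᵖ ∈ F`
    have hsplit : (2 : ℚ) ^ E = (2 : ℚ) ^ p * (2 : ℚ) ^ (E - p) := by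
      rw [← zpow_natCast, ← zpow_add₀ (by norm_num : (2 : ℚ) ≠ 0)]
      congr 1
      omega
    have hg : IsFloat p emin ((2 : ℚ) ^ E - (2 : ℚ) ^ (E - p)) := by
      have h1p : (1 : ℤ) ≤ 2 ^ p := one_le_pow₀ (by norm_num)
      have hN : |(2 ^ p - 1 : ℤ)| ≤ 2 ^ p := by
        rw [abs_of_nonneg (by omega)]
        omega
      have hfl := isFloat_of_abs_le (emin := emin) hp hN (k := E - p) (by omega)
      convert hfl using 2
      rw [hsplit]
      push_cast
      ring
    have hglt : (2 : ℚ) ^ E - (2 : ℚ) ^ (E - p) < f := by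
      rw [hfeq]
      linarith [two_zpow_pos (E - p)]
    have h3 := h.2.1 _ hg hglt
    -- hence `2ᴱ⁻¹ ≤ r`, `ufp(r) ≥ 2ᴱ⁻¹` and `f − r < 2ᴱ⁻ᵖ = 2eps·2ᴱ⁻¹`
    have hhalf : (2 : ℚ) ^ (E - 1) = (2 : ℚ) ^ E / 2 := by
      rw [zpow_sub_one₀ (by norm_num : (2 : ℚ) ≠ 0)]
      ring
    have hpe : (2 : ℚ) ^ (E - p) ≤ (2 : ℚ) ^ (E - 1) := zpow_le_zpow_right₀ (by norm_num) (by omega)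
    have hrpos : 0 < r := by linarith [two_zpow_pos E]
    have hr1 : (2 : ℚ) ^ (E - 1) ≤ |r| := by
      rw [abs_of_pos hrpos]
      linarith
    have hufpr : (2 : ℚ) ^ (E - 1) ≤ ufp r := two_zpow_le_ufp hr1
    have h4 : 2 * unitRoundoff p * (2 : ℚ) ^ (E - 1) = (2 : ℚ) ^ (E - p) := by
      rw [two_mul_u_mul_two_zpow]
      congr 1
      ring
    have h5 : |r - f| < (2 : ℚ) ^ (E - p) := by
      rw [abs_sub_lt_iff]
      constructor <;> linarith
    calc |r - f| < (2 : ℚ) ^ (E - p) := h5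
      _ = 2 * unitRoundoff p * (2 : ℚ) ^ (E - 1) := h4.symm
      _ ≤ 2 * unitRoundoff p * ufp r := by nlinarith

/-- **LEMMA 5.1, eq. (5.2).** `f ∉ U` (`|f| > ½eps⁻¹eta`) and `f ∈ □(r)` ⟹ `|r − f| < 2eps·ufp(r)` and
`|r − f| < 2eps·ufp(f)`. [cite: RumpOgitaOishi2009, Lemma 5.1 eq. (5.2)] -/
theorem faithful_abs_sub_lt_two_u_ufp (hp : 1 ≤ p) {f r : ℚ} (h : IsFaithfulRounding p emin f r)
    (hU : (2 : ℚ) ^ (emin + p - 1) < |f|) :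
    |r - f| < 2 * unitRoundoff p * ufp r ∧ |r - f| < 2 * unitRoundoff p * ufp f := by
  have hf0 : f ≠ 0 := by
    rintro rfl
    rw [abs_zero] at hU
    exact absurd hU (not_lt.mpr (two_zpow_pos _).le)
  refine ⟨?_, ?_⟩
  · rcases lt_or_gt_of_ne hf0 with hneg | hpos
    · have h' := faithful_abs_sub_lt_two_u_ufp_arg_of_pos hp (isFaithfulRounding_neg h)
        (by rwa [abs_neg]) (neg_pos.mpr hneg)
      rw [ufp_neg, show (-r) - (-f) = -(r - f) by ring, abs_neg] at h'
      exact h'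
    · exact faithful_abs_sub_lt_two_u_ufp_arg_of_pos hp h hU hpos
  · have hm := isFloat_add_two_u_ufp_of_not_mem_U hp h.1 hU (-1) (by simp)
    have hp' := isFloat_add_two_u_ufp_of_not_mem_U hp h.1 hU 1 (by simp)
    simp only [Int.cast_neg, Int.cast_one, neg_mul, one_mul] at hm hp'
    have hpos : 0 < 2 * unitRoundoff p * ufp f := by
      have := ufp_pos hf0
      have := u_pos (p := p)
      positivity
    have h1 := h.2.1 _ hm (by linarith)
    have h2 := h.2.2 _ hp' (by linarith)
    rw [abs_sub_lt_iff]
    constructor <;> linarith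

/-- "because the rightmost expression is a power of 2" (proof of Proposition 5.6): `|x| < 2eps·ufp(y)`
⟹ `ufp(x) ≤ eps·ufp(y)`. [cite: RumpOgitaOishi2009, Proposition 5.6 (proof of eq. (5.14))] -/
theorem ufp_le_u_mul_ufp_of_abs_lt {x y : ℚ} (h : |x| < 2 * unitRoundoff p * ufp y) :
    ufp x ≤ unitRoundoff p * ufp y := by
  by_cases hy : y = 0
  · rw [hy, ufp_zero, mul_zero] at h
    exact absurd h (not_lt.mpr (abs_nonneg x))
  · rw [ufp_of_ne_zero hy, two_mul_u_mul_two_zpow] at h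
    rw [ufp_of_ne_zero hy, u_mul_two_zpow]
    exact ufp_le_two_zpow_of_abs_lt h

/-- **PROPOSITION 5.6, eq. (5.14)**, one step: `fᵢ ∉ U`, `fᵢ ∈ □(Δᵢ₋₁)`, `Δᵢ = Δᵢ₋₁ − fᵢ` ⟹
`ufp(Δᵢ) ≤ eps·ufp(Δᵢ₋₁)` and `ufp(Δᵢ) ≤ eps·ufp(fᵢ)` (Lemma 5.1, eq. (5.2), and the previous lemma).
[cite: RumpOgitaOishi2009, Proposition 5.6 eq. (5.14)] -/
theorem faithful_ufp_sub_le (hp : 1 ≤ p) {f r : ℚ} (h : IsFaithfulRounding p emin f r)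
    (hU : (2 : ℚ) ^ (emin + p - 1) < |f|) :
    ufp (r - f) ≤ unitRoundoff p * ufp r ∧ ufp (r - f) ≤ unitRoundoff p * ufp f :=
  let h52 := faithful_abs_sub_lt_two_u_ufp hp h hU
  ⟨ufp_le_u_mul_ufp_of_abs_lt h52.1, ufp_le_u_mul_ufp_of_abs_lt h52.2⟩

/-! ### §5, Definition 5.2: non-overlapping sequences; Lemma 5.3 -/

/-- Definition 5.2's condition (5.4) on two consecutive members `(fᵢ, fᵢ₊₁) = (f, g)` of a sequence:
`|g| < 2eps·ufp(f)` if `f ≠ 0`, and `g = 0` if `f = 0`. [cite: RumpOgitaOishi2009, Definition 5.2 eq. (5.4)] -/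
def NonOverlapStep (p : ℕ) (f g : ℚ) : Prop :=
  (f ≠ 0 → |g| < 2 * unitRoundoff p * ufp f) ∧ (f = 0 → g = 0)

/-- **DEFINITION 5.2 (non-overlapping sequence).** "A sequence of floating-point numbers `f₁, …, f_k ∈ F`
is called non-overlapping if `|fᵢ₊₁| < 2eps·ufp(fᵢ)` if `fᵢ ≠ 0`, `fᵢ₊₁ = 0` if `fᵢ = 0` (5.4) holds true for
`1 ≤ i < k`" — typed for a sequence `l : List ℚ` (`f₁ = l[0]`) as the chain condition (5.4) on consecutive
members; the printed indexed form is `nonOverlapping_iff_getElem`. (Membership in `F` is not part of the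
predicate; it is a hypothesis where needed, as in (5.6).) [cite: RumpOgitaOishi2009, Definition 5.2] -/
def NonOverlapping (p : ℕ) (l : List ℚ) : Prop :=
  l.IsChain (NonOverlapStep p)

/-- Definition 5.2 as printed: (5.4) "holds true for `1 ≤ i < k`".
[cite: RumpOgitaOishi2009, Definition 5.2 eq. (5.4)] -/
theorem nonOverlapping_iff_getElem {l : List ℚ} :
    NonOverlapping p l ↔ ∀ (i : ℕ) (_hi : i + 1 < l.length),
      (l[i] ≠ 0 → |l[i + 1]| < 2 * unitRoundoff p * ufp l[i]) ∧ (l[i] = 0 → l[i + 1] = 0) :=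
  List.isChain_iff_getElem

/-- The empty sequence is non-overlapping. [cite: RumpOgitaOishi2009, Definition 5.2] -/
@[simp] theorem nonOverlapping_nil : NonOverlapping p [] := List.IsChain.nil

/-- A one-member sequence is non-overlapping. [cite: RumpOgitaOishi2009, Definition 5.2] -/
@[simp] theorem nonOverlapping_singleton (f : ℚ) : NonOverlapping p [f] := List.IsChain.singleton f

/-- Definition 5.2 unfolded one step. [cite: RumpOgitaOishi2009, Definition 5.2 eq. (5.4)] -/
@[simp] theorem nonOverlapping_cons_cons {f g : ℚ} {l : List ℚ} :
    NonOverlapping p (f :: g :: l) ↔ NonOverlapStep p f g ∧ NonOverlapping p (g :: l) :=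
  List.isChain_cons_cons

/-- Dropping the first member keeps a sequence non-overlapping. [cite: RumpOgitaOishi2009, Definition 5.2] -/
theorem NonOverlapping.of_cons {f : ℚ} {l : List ℚ} (h : NonOverlapping p (f :: l)) : NonOverlapping p l :=
  List.IsChain.tail h

/-- (5.4) is satisfied by `(f, 0)` for every `f` ("trailing zeros are possible").
[cite: RumpOgitaOishi2009, Definition 5.2 (Remark)] -/
theorem nonOverlapStep_zero_right (f : ℚ) : NonOverlapStep p f 0 :=
  ⟨fun hf => by
    rw [abs_zero]
    have := ufp_pos hf
    have := u_pos (p := p)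
    positivity, fun _ => rfl⟩

/-- (5.4) with `fᵢ = 0` forces `fᵢ₊₁ = 0`. [cite: RumpOgitaOishi2009, Definition 5.2 eq. (5.4)] -/
theorem NonOverlapStep.eq_zero {g : ℚ} (h : NonOverlapStep p 0 g) : g = 0 :=
  h.2 rfl

/-- REMARK after Definition 5.2: "a sequence of zeros is by definition non-overlapping".
[cite: RumpOgitaOishi2009, Definition 5.2 (Remark)] -/
theorem nonOverlapping_replicate_zero (n : ℕ) : NonOverlapping p (List.replicate n (0 : ℚ)) :=
  List.isChain_iff_getElem.mpr fun i hi => by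
    simpa using nonOverlapStep_zero_right (p := p) 0

/-- REMARK after Definition 5.2: "trailing zeros are possible".
[cite: RumpOgitaOishi2009, Definition 5.2 (Remark)] -/
theorem NonOverlapping.append_replicate_zero {l : List ℚ} (h : NonOverlapping p l) (n : ℕ) :
    NonOverlapping p (l ++ List.replicate n 0) :=
  List.IsChain.append h (nonOverlapping_replicate_zero n) fun x _ y hy => by
    obtain rfl : y = 0 := List.eq_of_mem_replicate (List.mem_of_mem_head? hy)
    exact nonOverlapStep_zero_right x

/-- In a non-overlapping sequence a zero member is followed by zeros only (Definition 5.2, second clause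
of (5.4), iterated). [cite: RumpOgitaOishi2009, Definition 5.2 eq. (5.4)] -/
theorem NonOverlapping.eq_zero_of_head {l : List ℚ} :
    ∀ {f : ℚ}, NonOverlapping p (f :: l) → f = 0 → ∀ x ∈ f :: l, x = 0 := by
  induction l with
  | nil =>
    intro f _ hf x hx
    rw [List.mem_singleton] at hx
    rw [hx, hf]
  | cons g l ih =>
    intro f h hf x hx
    rw [nonOverlapping_cons_cons] at h
    have hg : g = 0 := h.1.2 hf
    rcases List.mem_cons.mp hx with rfl | hx
    · exact hf
    · exact ih h.2 hg x hx

/-- **LEMMA 5.3, eq. (5.7)**: "Let `(f, g)` be a non-overlapping sequence. Then the definition (5.4) of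
non-overlapping implies `ufp(g) ≤ eps·ufp(f)`." [cite: RumpOgitaOishi2009, Lemma 5.3 eq. (5.7)] -/
theorem NonOverlapStep.ufp_le {f g : ℚ} (h : NonOverlapStep p f g) : ufp g ≤ unitRoundoff p * ufp f := by
  by_cases hf : f = 0
  · rw [h.2 hf, hf, ufp_zero, mul_zero]
  · exact ufp_le_u_mul_ufp_of_abs_lt (h.1 hf)

/-- (5.4) is transitive — the reason behind the Remark after Lemma 5.3 (subsequences are non-overlapping):
`|h| < 2eps·ufp(g) ≤ 2eps²·ufp(f) ≤ 2eps·ufp(f)` by (5.7). [cite: RumpOgitaOishi2009, Lemma 5.3 (Remark)] -/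
theorem NonOverlapStep.trans {f g h : ℚ} (h₁ : NonOverlapStep p f g) (h₂ : NonOverlapStep p g h) :
    NonOverlapStep p f h := by
  refine ⟨fun hf => ?_, fun hf => h₂.2 (h₁.2 hf)⟩
  have hu := u_pos (p := p)
  have hf' := ufp_pos hf
  by_cases hg : g = 0
  · rw [h₂.2 hg, abs_zero]
    positivity
  · have h3 := h₂.1 hg
    have h4 := h₁.ufp_le
    have h5 : unitRoundoff p * ufp f ≤ ufp f := mul_le_of_le_one_left (ufp_nonneg f) u_le_one
    calc |h| < 2 * unitRoundoff p * ufp g := h3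
      _ ≤ 2 * unitRoundoff p * (unitRoundoff p * ufp f) := by nlinarith
      _ ≤ 2 * unitRoundoff p * ufp f := by nlinarith

/-- (5.4) composes along a chain (`NonOverlapStep.trans`), registered for `calc` and for `List.IsChain.sublist`
(the subsequence Remark after Lemma 5.3). [cite: RumpOgitaOishi2009, Lemma 5.3 (Remark)] -/
instance instTransNonOverlapStep : Trans (NonOverlapStep p) (NonOverlapStep p) (NonOverlapStep p) :=
  ⟨NonOverlapStep.trans⟩

/-- REMARK after Lemma 5.3: "Lemma 5.3 is applicable to any subsequence `f_{i₁}, …, f_{i_m}` … because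
it is non-overlapping as well." [cite: RumpOgitaOishi2009, Lemma 5.3 (Remark)] -/
theorem NonOverlapping.sublist {l l' : List ℚ} (h : NonOverlapping p l) (hs : l'.Sublist l) :
    NonOverlapping p l' :=
  List.IsChain.sublist h hs

/-- **LEMMA 5.3, eq. (5.5)**, member-wise: in a non-overlapping sequence `ufp(fᵢ₊₁) ≤ epsⁱ·ufp(f₁)`
(`0 ≤ i < k`), by iterating (5.7). [cite: RumpOgitaOishi2009, Lemma 5.3 eq. (5.5)] -/
theorem NonOverlapping.ufp_getElem_le {l : List ℚ} (h : NonOverlapping p l) :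
    ∀ (i : ℕ) (hi : i < l.length), ufp l[i] ≤ unitRoundoff p ^ i * ufp (l[0]'(by omega)) := by
  intro i
  induction i with
  | zero =>
    intro hi
    simp
  | succ i ih =>
    intro hi
    have h1 := (List.IsChain.getElem h i hi).ufp_le
    have h2 := ih (by omega)
    calc ufp l[i + 1] ≤ unitRoundoff p * ufp l[i] := h1
      _ ≤ unitRoundoff p * (unitRoundoff p ^ i * ufp l[0]) := mul_le_mul_of_nonneg_left h2 u_pos.le
      _ = unitRoundoff p ^ (i + 1) * ufp l[0] := by ring

/-- **LEMMA 5.3, eq. (5.5)** as printed: "Let `f₁, …, f_k` be a non-overlapping sequence of floating-point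
numbers. Then `ufp(f_k) ≤ epsᵏ⁻¹·ufp(f₁)`." [cite: RumpOgitaOishi2009, Lemma 5.3 eq. (5.5)] -/
theorem NonOverlapping.ufp_getLast_le {l : List ℚ} (h : NonOverlapping p l) (hne : l ≠ []) :
    ufp (l.getLast hne) ≤ unitRoundoff p ^ (l.length - 1) * ufp (l.head hne) := by
  rw [List.getLast_eq_getElem, List.head_eq_getElem]
  exact h.ufp_getElem_le _ _

/-- **LEMMA 5.3, eq. (5.8)**: for `f ∈ F` and `(f, g)` non-overlapping, `|f| + 2ufp(g) ≤ 2ufp(f)` (the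
largest float below `2ufp(f)` is at most `2ufp(f) − 2eps·ufp(f)`, and `ufp(g) ≤ eps·ufp(f)` by (5.7); no
hypothesis on `g`, and no case distinction `f ∈ U` / `f ∉ U` is needed). [cite: RumpOgitaOishi2009, Lemma 5.3 eq. (5.8)] -/
theorem NonOverlapStep.abs_add_two_ufp_le (hp : 1 ≤ p) {f g : ℚ} (hf : IsFloat p emin f)
    (h : NonOverlapStep p f g) : |f| + 2 * ufp g ≤ 2 * ufp f := by
  by_cases hf0 : f = 0
  · rw [hf0, h.2 hf0, ufp_zero, abs_zero]
    norm_num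
  · have hE := ufp_of_ne_zero hf0
    have hfE : |f| < (2 : ℚ) ^ (Int.log 2 |f| + 1) := abs_lt_zpow_log_succ f
    have h1 := abs_le_sub_of_abs_lt_two_zpow hp hf hfE
    have h2 := h.ufp_le
    rw [hE, u_mul_two_zpow] at h2
    have h3 : (2 : ℚ) ^ (Int.log 2 |f| + 1) = 2 * (2 : ℚ) ^ Int.log 2 |f| := by
      rw [zpow_add_one₀ (by norm_num : (2 : ℚ) ≠ 0)]
      ring
    have h4 : (2 : ℚ) ^ (Int.log 2 |f| + 1 - p) = 2 * (2 : ℚ) ^ (Int.log 2 |f| - p) := by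
      rw [show Int.log 2 |f| + 1 - (p : ℤ) = (Int.log 2 |f| - p) + 1 by ring,
        zpow_add_one₀ (by norm_num : (2 : ℚ) ≠ 0)]
      ring
    rw [hE]
    linarith

/-- **LEMMA 5.3, eq. (5.6).** For a non-overlapping sequence `f₁, …, f_k ∈ F` with `f₁ ≠ 0`,
`|Σ fν| < 2ufp(f₁)` — by (5.8) from the back: `|Σ_{ν≤k} fν| < Σ_{ν≤k−1} |fν| + 2ufp(f_k) ≤ … ≤ 2ufp(f₁)`.
NOTE: the printed statement has no hypothesis `f₁ ≠ 0`; for the zero sequence (which Definition 5.2's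
Remark explicitly admits) it would read `0 < 0`. Zeros propagate (`NonOverlapping.eq_zero_of_head`), so
`f₁ ≠ 0` is exactly the non-degenerate case. [cite: RumpOgitaOishi2009, Lemma 5.3 eq. (5.6)] -/
theorem NonOverlapping.abs_sum_lt_two_ufp (hp : 1 ≤ p) {l : List ℚ} :
    ∀ {f : ℚ}, (∀ x ∈ f :: l, IsFloat p emin x) → NonOverlapping p (f :: l) → f ≠ 0 →
      |(f :: l).sum| < 2 * ufp f := by
  induction l with
  | nil =>
    intro f _ _ hf
    simpa using abs_lt_two_mul_ufp hf
  | cons g l ih =>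
    intro f hF h hf
    rw [nonOverlapping_cons_cons] at h
    have h58 := h.1.abs_add_two_ufp_le hp (hF f (by simp))
    rw [List.sum_cons]
    by_cases hg : g = 0
    · have hz : (g :: l).sum = 0 := List.sum_eq_zero (h.2.eq_zero_of_head hg)
      rw [hz, add_zero]
      exact abs_lt_two_mul_ufp hf
    · have ih' := ih (fun x hx => hF x (List.mem_cons_of_mem _ hx)) h.2 hg
      calc |f + (g :: l).sum| ≤ |f| + |(g :: l).sum| := abs_add_le _ _
        _ < |f| + 2 * ufp g := by linarith
        _ ≤ 2 * ufp f := h58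

/-- **LEMMA 5.3, eq. (5.6)** with `f₁ = l.head`. [cite: RumpOgitaOishi2009, Lemma 5.3 eq. (5.6)] -/
theorem NonOverlapping.abs_sum_lt_two_ufp_head (hp : 1 ≤ p) {l : List ℚ} (hF : ∀ x ∈ l, IsFloat p emin x)
    (h : NonOverlapping p l) (hne : l ≠ []) (h0 : l.head hne ≠ 0) : |l.sum| < 2 * ufp (l.head hne) := by
  obtain ⟨f, l', rfl⟩ : ∃ f l', l = f :: l' := by
    cases l with
    | nil => exact absurd rfl hne
    | cons f l' => exact ⟨f, l', rfl⟩
  exact h.abs_sum_lt_two_ufp hp hF h0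

/-! ### §5, eq. (5.9), Definition 5.4: (k-fold) faithful and strongly faithful rounding of `s` -/

/-- **DEFINITION 5.4 ((k-fold) faithful rounding).** "A sequence `f₁, …, f_k ∈ F` is called a (k-fold)
faithful rounding of `s ∈ ℝ` if `fᵢ ∈ □(s − Σ_{ν<i} fν)` for `1 ≤ i ≤ k`" (5.10) — typed recursively
(`f₁ ∈ □(s)` and `f₂, …, f_k` is a faithful rounding of `s − f₁`); the printed indexed form is
`isKFoldFaithful_iff_getElem`, the form (5.12) with `pred`/`succ` is `IsKFoldFaithful.pred_lt_lt_succ`.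
`□` is Definition 2.2 = Part I Definition 2.3, `RumpOgitaOishi2008.IsFaithfulRounding` (which includes `fᵢ ∈ F`).
[cite: RumpOgitaOishi2009, Definition 5.4 eq. (5.10)] -/
def IsKFoldFaithful (p : ℕ) (emin : ℤ) : List ℚ → ℚ → Prop
  | [], _ => True
  | f :: l, s => IsFaithfulRounding p emin f s ∧ IsKFoldFaithful p emin l (s - f)

/-- **DEFINITION 5.4 (strongly faithful rounding).** "The sequence is called a strongly faithful rounding if
it is in addition non-overlapping." [cite: RumpOgitaOishi2009, Definition 5.4] -/
def IsStronglyFaithful (p : ℕ) (emin : ℤ) (l : List ℚ) (s : ℚ) : Prop :=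
  IsKFoldFaithful p emin l s ∧ NonOverlapping p l

/-- The empty sequence (k = 0). [cite: RumpOgitaOishi2009, Definition 5.4] -/
@[simp] theorem isKFoldFaithful_nil (s : ℚ) : IsKFoldFaithful p emin [] s := trivial

/-- Definition 5.4 unfolded one step. [cite: RumpOgitaOishi2009, Definition 5.4 eq. (5.10)] -/
@[simp] theorem isKFoldFaithful_cons {f s : ℚ} {l : List ℚ} :
    IsKFoldFaithful p emin (f :: l) s ↔ IsFaithfulRounding p emin f s ∧ IsKFoldFaithful p emin l (s - f) :=
  Iff.rfl

/-- "Of course, a strongly faithful rounding is faithful". [cite: RumpOgitaOishi2009, Definition 5.4] -/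
theorem IsStronglyFaithful.isKFoldFaithful {l : List ℚ} {s : ℚ} (h : IsStronglyFaithful p emin l s) :
    IsKFoldFaithful p emin l s :=
  h.1

/-- A strongly faithful rounding is non-overlapping. [cite: RumpOgitaOishi2009, Definition 5.4] -/
theorem IsStronglyFaithful.nonOverlapping {l : List ℚ} {s : ℚ} (h : IsStronglyFaithful p emin l s) :
    NonOverlapping p l :=
  h.2

/-- Definition 5.4 as printed, eq. (5.10): `fᵢ ∈ □(s − Σ_{ν<i} fν)` for every member (`Σ_{ν<i} fν` is
`(l.take i).sum` for the member `l[i]`). [cite: RumpOgitaOishi2009, Definition 5.4 eq. (5.10)] -/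
theorem isKFoldFaithful_iff_getElem {l : List ℚ} {s : ℚ} :
    IsKFoldFaithful p emin l s ↔
      ∀ (i : ℕ) (hi : i < l.length), IsFaithfulRounding p emin l[i] (s - (l.take i).sum) := by
  induction l generalizing s with
  | nil => simp
  | cons f l ih =>
    rw [isKFoldFaithful_cons, ih]
    constructor
    · rintro ⟨hf, hl⟩ i hi
      cases i with
      | zero => simpa using hf
      | succ i =>
        have := hl i (by simpa using hi)
        simpa [List.take_succ_cons, sub_sub] using this
    · intro H
      have h0 := H 0 (by simp)
      refine ⟨by simpa using h0, fun i hi => ?_⟩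
      have := H (i + 1) (by simpa using hi)
      simpa [List.take_succ_cons, sub_sub] using this

/-- The members of a faithful rounding are floats ("`f₁, …, f_k ∈ F`"). [cite: RumpOgitaOishi2009, Definition 5.4] -/
theorem IsKFoldFaithful.isFloat {l : List ℚ} :
    ∀ {s : ℚ}, IsKFoldFaithful p emin l s → ∀ x ∈ l, IsFloat p emin x := by
  induction l with
  | nil => simp
  | cons f l ih =>
    intro s h x hx
    rcases List.mem_cons.mp hx with rfl | hx
    · exact h.1.1
    · exact ih h.2 x hx

/-- A leading subsequence `f₁, …, fᵢ` of a faithful rounding of `s` is a faithful rounding of `s`.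
[cite: RumpOgitaOishi2009, Definition 5.4 eq. (5.10)] -/
theorem IsKFoldFaithful.take {l : List ℚ} :
    ∀ {s : ℚ}, IsKFoldFaithful p emin l s → ∀ i : ℕ, IsKFoldFaithful p emin (l.take i) s := by
  induction l with
  | nil => intro s _ i; simp
  | cons f l ih =>
    intro s h i
    cases i with
    | zero => simp
    | succ i =>
      rw [List.take_succ_cons]
      exact ⟨h.1, ih h.2 i⟩

/-- The tail `fᵢ₊₁, …, f_k` of a faithful rounding of `s` is a faithful rounding of `Δᵢ = s − Σ_{ν≤i} fν`
(the notation of the proof of Proposition 5.6). [cite: RumpOgitaOishi2009, Definition 5.4 / Proposition 5.6 (proof)] -/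
theorem IsKFoldFaithful.drop {l : List ℚ} :
    ∀ {s : ℚ}, IsKFoldFaithful p emin l s → ∀ i : ℕ, IsKFoldFaithful p emin (l.drop i) (s - (l.take i).sum) := by
  induction l with
  | nil => intro s _ i; simp
  | cons f l ih =>
    intro s h i
    cases i with
    | zero => simpa using h
    | succ i =>
      rw [List.drop_succ_cons, List.take_succ_cons, List.sum_cons, ← sub_sub]
      exact ih h.2 i

/-- Two consecutive members: `fᵢ ∈ □(Δᵢ₋₁)` and `fᵢ₊₁ ∈ □(Δᵢ₋₁ − fᵢ)`.
[cite: RumpOgitaOishi2009, Definition 5.4 eq. (5.10)] -/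
theorem IsKFoldFaithful.pair {l : List ℚ} {s : ℚ} (h : IsKFoldFaithful p emin l s) (i : ℕ)
    (hi : i + 1 < l.length) :
    IsFaithfulRounding p emin (l[i]'(by omega)) (s - (l.take i).sum) ∧
      IsFaithfulRounding p emin l[i + 1] (s - (l.take i).sum - l[i]'(by omega)) := by
  have H := isKFoldFaithful_iff_getElem.mp h
  refine ⟨H i (by omega), ?_⟩
  have := H (i + 1) hi
  rwa [List.sum_take_succ _ _ (by omega), ← sub_sub] at this

/-- Eq. (5.12): "by definition `Σ_{ν<m} fν + pred(f_m) < s < Σ_{ν<m} fν + succ(f_m)` for `1 ≤ m ≤ k`".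
[cite: RumpOgitaOishi2009, Lemma 5.5 eq. (5.12)] -/
theorem IsKFoldFaithful.pred_lt_lt_succ (hp : 1 ≤ p) {l : List ℚ} {s : ℚ} (h : IsKFoldFaithful p emin l s)
    (i : ℕ) (hi : i < l.length) {g g' : ℚ} (hg : IsPred p emin l[i] g) (hg' : IsSucc p emin l[i] g') :
    (l.take i).sum + g < s ∧ s < (l.take i).sum + g' := by
  have hm := isKFoldFaithful_iff_getElem.mp h i hi
  have := (isFaithfulRounding_iff_pred_lt_lt_succ hp hm.1).mp hm g g' hg hg'
  constructor <;> linarith [this.1, this.2]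

/-- A faithful rounding of `0` is a sequence of zeros (`f ∈ □(0) ⟹ f = 0`, Part I eq. (2.26), iterated).
[cite: RumpOgitaOishi2009, Definition 5.4 / Lemma 5.5] -/
theorem IsKFoldFaithful.eq_zero_of_zero {l : List ℚ} :
    ∀ {s : ℚ}, IsKFoldFaithful p emin l s → s = 0 → ∀ x ∈ l, x = 0 := by
  induction l with
  | nil => simp
  | cons f l ih =>
    intro s h hs x hx
    have hf : f = 0 := h.1.sign.2.2 hs
    rcases List.mem_cons.mp hx with rfl | hx
    · exact hf
    · exact ih h.2 (by rw [hs, hf, sub_zero]) x hx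

/-! ### §5, Lemma 5.5: members overlap in at most one bit; where subnormal members can occur -/

/-- **LEMMA 5.5, eq. (5.11)**, for two consecutive members `a = fᵢ₋₁ ∈ □(Δ)`, `b = fᵢ ∈ □(Δ − a)`: if
`|a| ≥ ½eps⁻¹eta` then `|b| ≤ 2eps·ufp(a)` ("`ufp(fᵢ) ≤ fᵢ ≤ succ(fᵢ₋₁) − fᵢ₋₁ ≤ 2eps·ufp(fᵢ₋₁)`": the float
`2eps·ufp(a)` lies below `b` only if it lies below `Δ − a < succ(a) − a ≤ 2eps·ufp(a)`).
[cite: RumpOgitaOishi2009, Lemma 5.5 eq. (5.11)] -/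
theorem abs_le_two_u_ufp_of_faithful_pair (hp : 1 ≤ p) {a b Δ : ℚ} (ha : IsFaithfulRounding p emin a Δ)
    (hb : IsFaithfulRounding p emin b (Δ - a)) (hU : (2 : ℚ) ^ (emin + p - 1) ≤ |a|) :
    |b| ≤ 2 * unitRoundoff p * ufp a := by
  have ha0 : a ≠ 0 := by
    rintro rfl
    rw [abs_zero] at hU
    exact absurd hU (not_le.mpr (two_zpow_pos _))
  have hpos : 0 < 2 * unitRoundoff p * ufp a := by
    have := ufp_pos ha0
    have := u_pos (p := p)
    positivity
  -- the float `G := 2eps·ufp(a) = 2^(E − p + 1)`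
  have hfE : |a| < (2 : ℚ) ^ (Int.log 2 |a| + 1) := abs_lt_zpow_log_succ a
  have hGeq : 2 * unitRoundoff p * ufp a = (2 : ℚ) ^ (Int.log 2 |a| - p + 1) := by
    rw [ufp_of_ne_zero ha0, two_mul_u_mul_two_zpow]
  have hElow : emin ≤ Int.log 2 |a| - p + 1 := by
    by_contra hlt
    rw [not_le] at hlt
    have : (2 : ℚ) ^ (Int.log 2 |a| + 1) ≤ (2 : ℚ) ^ (emin + p - 1) :=
      zpow_le_zpow_right₀ (by norm_num) (by omega)
    linarith
  have hG : IsFloat p emin (2 * unitRoundoff p * ufp a) := by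
    rw [hGeq]
    exact isFloat_two_zpow hp hElow
  -- `a ∓ G ∈ F` bound `Δ`: `a − G < Δ < a + G`
  have hm := isFloat_add_two_u_ufp_of_threshold_le hp ha.1 hU (-1) (by simp)
  have hp' := isFloat_add_two_u_ufp_of_threshold_le hp ha.1 hU 1 (by simp)
  simp only [Int.cast_neg, Int.cast_one, neg_mul, one_mul] at hm hp'
  have h1 := ha.2.1 _ hm (by linarith)
  have h2 := ha.2.2 _ hp' (by linarith)
  rw [abs_le]
  constructor
  · by_contra hlt
    rw [not_le] at hlt
    have := hb.2.2 _ hG.neg hlt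
    linarith
  · by_contra hlt
    rw [not_le] at hlt
    have := hb.2.1 _ hG hlt
    linarith

/-- **LEMMA 5.5, eq. (5.11)** for a sequence: if `f₁, …, f_k` is a faithful rounding of `s` and
`|fᵢ₋₁| ≥ ½eps⁻¹eta`, then `|fᵢ| ≤ 2eps·ufp(fᵢ₋₁)` ("the members … may overlap in at most one bit").
[cite: RumpOgitaOishi2009, Lemma 5.5 eq. (5.11)] -/
theorem IsKFoldFaithful.abs_getElem_succ_le (hp : 1 ≤ p) {l : List ℚ} {s : ℚ}
    (h : IsKFoldFaithful p emin l s) (i : ℕ) (hi : i + 1 < l.length)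
    (hU : (2 : ℚ) ^ (emin + p - 1) ≤ |l[i]'(by omega)|) :
    |l[i + 1]| ≤ 2 * unitRoundoff p * ufp (l[i]'(by omega)) := by
  obtain ⟨ha, hb⟩ := h.pair i hi
  exact abs_le_two_u_ufp_of_faithful_pair hp ha hb hU

/-- **LEMMA 5.5, the equality clause of (5.11)**, in the direction that holds: equality
`|fᵢ| = 2eps·ufp(fᵢ₋₁)` (with `fᵢ₋₁ ≠ 0`) forces `ufp(fᵢ) = |fᵢ|`, i.e. `fᵢ` is a power of 2 — so two
consecutive members share at most the one bit `2eps·ufp(fᵢ₋₁)`. NOTE: the printed "with equality if and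
only if `ufp(fᵢ) = |fᵢ|`" fails in the "if" direction (`lemma_5_5_iff_converse_fails` below).
[cite: RumpOgitaOishi2009, Lemma 5.5 eq. (5.11)] -/
theorem ufp_eq_abs_of_abs_eq_two_u_ufp {a b : ℚ} (ha : a ≠ 0) (h : |b| = 2 * unitRoundoff p * ufp a) :
    ufp b = |b| := by
  rw [← ufp_abs, h, ufp_of_ne_zero ha, two_mul_u_mul_two_zpow, ufp_two_zpow]

/-- The mechanism behind the last two clauses of LEMMA 5.5 (and behind "`f_k ∉ U` implies `fᵢ ∉ U` for
`1 ≤ i ≤ k`" in the proof of Proposition 5.6): for consecutive members `a ∈ □(Δ)`, `b ∈ □(Δ − a)`, if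
`a ∈ U` (`|a| ≤ ½eps⁻¹eta`) then `|Δ − a| < eta` by (5.3), hence `|b| ≤ eta` (the float `eta` lies below `|b|`
only if it lies below `|Δ − a|`). [cite: RumpOgitaOishi2009, Lemma 5.5 (proof)] -/
theorem abs_le_eta_of_faithful_pair (hp : 1 ≤ p) {a b Δ : ℚ} (ha : IsFaithfulRounding p emin a Δ)
    (hb : IsFaithfulRounding p emin b (Δ - a)) (hU : |a| ≤ (2 : ℚ) ^ (emin + p - 1)) :
    |b| ≤ (2 : ℚ) ^ emin := by
  have hlt := faithful_abs_sub_lt_eta hp ha hU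
  rw [abs_sub_lt_iff] at hlt
  have heta : IsFloat p emin ((2 : ℚ) ^ emin) := isFloat_two_zpow hp le_rfl
  rw [abs_le]
  constructor
  · by_contra h
    rw [not_le] at h
    have := hb.2.2 _ heta.neg h
    linarith [hlt.1]
  · by_contra h
    rw [not_le] at h
    have := hb.2.1 _ heta h
    linarith [hlt.2]

/-- **LEMMA 5.5, "Moreover, `|f_m| > 2eta` implies `fᵢ ∉ U` for `1 ≤ i < m`"** — typed from the WEAKER
hypothesis `|f_m| > eta` (so this contains the printed clause): in a faithful rounding every member before a
member of magnitude `> eta` lies outside `U` (`|fᵢ| > ½eps⁻¹eta`); by `abs_le_eta_of_faithful_pair` and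
induction ("an induction argument finishes the proof"). [cite: RumpOgitaOishi2009, Lemma 5.5] -/
theorem IsKFoldFaithful.threshold_lt_abs_of_eta_lt_abs (hp : 1 ≤ p) {l : List ℚ} :
    ∀ {s : ℚ}, IsKFoldFaithful p emin l s →
      ∀ {i j : ℕ} (hi : i < l.length) (hj : j < l.length), i < j →
        (2 : ℚ) ^ emin < |l[j]| → (2 : ℚ) ^ (emin + p - 1) < |l[i]| := by
  induction l with
  | nil => intro s _ i j hi; simp at hi
  | cons f l ih =>
    intro s h i j hi hj hij hm
    cases j with
    | zero => omega
    | succ j =>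
      have hj' : j < l.length := by simpa using hj
      simp only [List.getElem_cons_succ] at hm
      cases i with
      | zero =>
        simp only [List.getElem_cons_zero]
        -- the member right after `f` has magnitude `> eta`
        have hl0 : 0 < l.length := by omega
        have hnext : (2 : ℚ) ^ emin < |l[0]| := by
          cases j with
          | zero => exact hm
          | succ j =>
            have h' := ih h.2 hl0 hj' (by omega) hm
            exact lt_of_le_of_lt (zpow_le_zpow_right₀ (by norm_num) (by omega)) h'
        obtain ⟨g, l', rfl⟩ : ∃ g l', l = g :: l' := by
          cases l with
          | nil => simp at hl0
          | cons g l' => exact ⟨g, l', rfl⟩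
        simp only [List.getElem_cons_zero] at hnext
        by_contra hle
        rw [not_lt] at hle
        have := abs_le_eta_of_faithful_pair hp h.1 h.2.1 hle
        linarith
      | succ i =>
        simp only [List.getElem_cons_succ]
        exact ih h.2 (by simpa using hi) hj' (by omega) hm

/-- **LEMMA 5.5, "… and `|f_m| < ½eps⁻¹eta` implies `fᵢ = 0` for `m < i ≤ k`"**, for `s ∈ etaℤ` (the
source's "main application", the sum of floating-point numbers; then even `|f_m| ≤ ½eps⁻¹eta` suffices:
`f_m ∈ U` forces `Δ_m = 0` by Lemma 5.1's Remark, and a faithful rounding of `0` is zero). NOTE: for a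
general real `s` the printed clause FAILS (`lemma_5_5_last_clause_needs_grid` below).
[cite: RumpOgitaOishi2009, Lemma 5.5] -/
theorem IsKFoldFaithful.getElem_eq_zero_of_abs_le_threshold (hp : 1 ≤ p) {l : List ℚ} :
    ∀ {s : ℚ}, IsKFoldFaithful p emin l s → OnGrid ((2 : ℚ) ^ emin) s →
      ∀ {i j : ℕ} (hi : i < l.length) (hj : j < l.length), i < j →
        |l[i]| ≤ (2 : ℚ) ^ (emin + p - 1) → l[j] = 0 := by
  induction l with
  | nil => intro s _ _ i j hi; simp at hi
  | cons f l ih =>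
    intro s h hs i j hi hj hij hU
    cases j with
    | zero => omega
    | succ j =>
      simp only [List.getElem_cons_succ]
      have hj' : j < l.length := by simpa using hj
      cases i with
      | zero =>
        simp only [List.getElem_cons_zero] at hU
        have hsf : f = s := faithful_eq_of_mem_U_of_onGrid hp h.1 hU hs
        exact h.2.eq_zero_of_zero (by rw [hsf, sub_self]) _ (List.getElem_mem hj')
      | succ i =>
        simp only [List.getElem_cons_succ] at hU
        exact ih h.2 (hs.sub (onGrid_eta_of_isFloat h.1.1)) (by simpa using hi) hj' (by omega) hU

/-- Floats of the toy format `p = 3`, `emin = 0` (used for the two kernel-checked NOTES below) are integers.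
[cite: RumpOgitaOishi2009, §2 (F ⊆ etaℤ)] -/
theorem exists_int_eq_of_isFloat_three_zero {g : ℚ} (hg : IsFloat 3 0 g) : ∃ n : ℤ, g = n := by
  obtain ⟨N, hN⟩ := hg.exists_int_mul_zpow_emin
  exact ⟨N, by simpa using hN⟩

/-- NOTE on LEMMA 5.5, last clause, for a general real `s` (kernel-checked counterexample): with `p = 3`,
`emin = 0` (`eta = 1`, `½eps⁻¹eta = 4`), the sequence `(f₁, f₂) = (1, 1)` is a 2-fold faithful rounding of
`s = 3/2` (`pred(1) = 0 < 3/2 < 2 = succ(1)` and `0 < 3/2 − 1 < 2`), `|f₁| = 1 < ½eps⁻¹eta`, yet `f₂ ≠ 0`.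
The clause holds for `s ∈ etaℤ` (`IsKFoldFaithful.getElem_eq_zero_of_abs_le_threshold`).
[cite: RumpOgitaOishi2009, Lemma 5.5] -/
theorem lemma_5_5_last_clause_needs_grid :
    IsKFoldFaithful 3 0 [1, 1] (3 / 2) ∧ |(1 : ℚ)| < (2 : ℚ) ^ ((0 : ℤ) + (3 : ℕ) - 1) ∧ (1 : ℚ) ≠ 0 := by
  have h1 : IsFloat 3 0 (1 : ℚ) := ⟨1, 0, by norm_num, le_rfl, by norm_num⟩
  refine ⟨?_, by norm_num, one_ne_zero⟩
  simp only [isKFoldFaithful_cons, isKFoldFaithful_nil, and_true]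
  refine ⟨⟨h1, fun g _ hlt => by linarith, fun g hg hlt => ?_⟩,
    ⟨h1, fun g hg hlt => ?_, fun g _ hlt => by linarith⟩⟩
  · obtain ⟨n, rfl⟩ := exists_int_eq_of_isFloat_three_zero hg
    have hn : (1 : ℤ) < n := by exact_mod_cast hlt
    have hn' : (2 : ℚ) ≤ n := by exact_mod_cast (show (2 : ℤ) ≤ n by omega)
    linarith
  · obtain ⟨n, rfl⟩ := exists_int_eq_of_isFloat_three_zero hg
    have hn : n < (1 : ℤ) := by exact_mod_cast hlt
    have hn' : (n : ℚ) ≤ 0 := by exact_mod_cast (show n ≤ (0 : ℤ) by omega)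
    linarith

/-- NOTE on LEMMA 5.5, the "if" of "with equality if and only if `ufp(fᵢ) = |fᵢ|`" (kernel-checked
counterexample): with `p = 3`, `emin = 0`, the sequence `(f₁, f₂) = (16, 1)` is a 2-fold faithful rounding of
`s = 17` (`pred(16) = 14 < 17 < 20 = succ(16)`, `17 − 16 = 1 ∈ F`), `|f₁| = 16 ≥ ½eps⁻¹eta = 4` and
`ufp(f₂) = |f₂|`, yet `|f₂| = 1 < 4 = 2eps·ufp(f₁)`: no equality in (5.11).
[cite: RumpOgitaOishi2009, Lemma 5.5 eq. (5.11)] -/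
theorem lemma_5_5_iff_converse_fails :
    IsKFoldFaithful 3 0 [16, 1] 17 ∧ (2 : ℚ) ^ ((0 : ℤ) + (3 : ℕ) - 1) ≤ |(16 : ℚ)| ∧
      ufp (1 : ℚ) = |(1 : ℚ)| ∧ |(1 : ℚ)| < 2 * unitRoundoff 3 * ufp (16 : ℚ) := by
  have h1 : IsFloat 3 0 (1 : ℚ) := ⟨1, 0, by norm_num, le_rfl, by norm_num⟩
  have h16 : IsFloat 3 0 (16 : ℚ) := ⟨4, 2, by norm_num, by norm_num, by norm_num⟩
  have hufp1 : ufp (1 : ℚ) = 1 := by simpa using ufp_two_zpow 0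
  have hufp16 : ufp (16 : ℚ) = 16 := by
    have := ufp_two_zpow 4
    norm_num at this
    exact this
  refine ⟨?_, by norm_num, by rw [hufp1, abs_one], by rw [hufp16, unitRoundoff]; norm_num⟩
  simp only [isKFoldFaithful_cons, isKFoldFaithful_nil, and_true]
  refine ⟨⟨h16, fun g _ hlt => by linarith, fun g hg hlt => ?_⟩, ?_⟩
  · -- a float above 16 is at least `16 + eps·16 = 18` (Part I, eq. (2.23))
    have h := u_mul_abs_le_abs_sub (by norm_num : 1 ≤ 3) h16 hg hlt.ne'
    rw [abs_of_pos (by norm_num : (0 : ℚ) < 16), abs_of_pos (sub_pos.mpr hlt), unitRoundoff] at h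
    norm_num at h
    linarith
  · rw [show (17 : ℚ) - 16 = 1 by norm_num]
    exact isFaithfulRounding_self h1

/-! ### §5, Proposition 5.6: the accuracy of a k-fold faithful rounding -/

/-- Proof of PROPOSITION 5.6: "Suppose `f_k ∉ U`, so that Lemma 5.5 implies `fᵢ ∉ U` for `1 ≤ i ≤ k`"
(backwards along the sequence by `abs_le_eta_of_faithful_pair`: a member in `U` is followed by a member of
magnitude `≤ eta ≤ ½eps⁻¹eta`). [cite: RumpOgitaOishi2009, Proposition 5.6 (proof)] -/
theorem IsKFoldFaithful.threshold_lt_abs_of_getLast (hp : 1 ≤ p) {l : List ℚ} :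
    ∀ {s : ℚ}, IsKFoldFaithful p emin l s → (hne : l ≠ []) →
      (2 : ℚ) ^ (emin + p - 1) < |l.getLast hne| → ∀ x ∈ l, (2 : ℚ) ^ (emin + p - 1) < |x| := by
  induction l with
  | nil => intro s _ hne; exact absurd rfl hne
  | cons f l ih =>
    intro s h hne hU x hx
    cases l with
    | nil =>
      rw [List.getLast_singleton] at hU
      rw [List.mem_singleton] at hx
      rw [hx]
      exact hU
    | cons g l' =>
      rw [List.getLast_cons (List.cons_ne_nil g l')] at hU
      have hall := ih h.2 (List.cons_ne_nil g l') hU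
      rcases List.mem_cons.mp hx with rfl | hx
      · have hg := hall g (by simp)
        by_contra hle
        rw [not_lt] at hle
        have h1 := abs_le_eta_of_faithful_pair hp h.1 h.2.1 hle
        have h2 : (2 : ℚ) ^ emin ≤ (2 : ℚ) ^ (emin + p - 1) := zpow_le_zpow_right₀ (by norm_num) (by omega)
        linarith
      · exact hall x hx

/-- Proof of PROPOSITION 5.6, eq. (5.14) iterated: if all members lie outside `U` then
`ufp(Δ_k) ≤ epsᵏ·ufp(s)` (`Δ_k = s − Σ fν`). [cite: RumpOgitaOishi2009, Proposition 5.6 (proof, eq. (5.14))] -/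
theorem IsKFoldFaithful.ufp_sub_sum_le (hp : 1 ≤ p) {l : List ℚ} :
    ∀ {s : ℚ}, IsKFoldFaithful p emin l s → (∀ x ∈ l, (2 : ℚ) ^ (emin + p - 1) < |x|) →
      ufp (s - l.sum) ≤ unitRoundoff p ^ l.length * ufp s := by
  induction l with
  | nil => intro s _ _; simp
  | cons f l ih =>
    intro s h hU
    have h1 := (faithful_ufp_sub_le hp h.1 (hU f (by simp))).1
    have h2 := ih h.2 (fun x hx => hU x (List.mem_cons_of_mem _ hx))
    rw [List.sum_cons, List.length_cons, ← sub_sub, pow_succ]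
    calc ufp (s - f - l.sum) ≤ unitRoundoff p ^ l.length * ufp (s - f) := h2
      _ ≤ unitRoundoff p ^ l.length * (unitRoundoff p * ufp s) :=
        mul_le_mul_of_nonneg_left h1 (pow_nonneg u_pos.le _)
      _ = unitRoundoff p ^ l.length * unitRoundoff p * ufp s := by ring

/-- Proof of PROPOSITION 5.6, eq. (5.14) iterated, with `ufp(f₁)`: if all members lie outside `U` then
`ufp(Δ_k) ≤ epsᵏ·ufp(f₁)`. [cite: RumpOgitaOishi2009, Proposition 5.6 (proof, eq. (5.14))] -/
theorem IsKFoldFaithful.ufp_sub_sum_le_head (hp : 1 ≤ p) {f : ℚ} {l : List ℚ} {s : ℚ}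
    (h : IsKFoldFaithful p emin (f :: l) s) (hU : ∀ x ∈ f :: l, (2 : ℚ) ^ (emin + p - 1) < |x|) :
    ufp (s - (f :: l).sum) ≤ unitRoundoff p ^ (l.length + 1) * ufp f := by
  have h1 := (faithful_ufp_sub_le hp h.1 (hU f (by simp))).2
  have h2 := h.2.ufp_sub_sum_le hp (fun x hx => hU x (List.mem_cons_of_mem _ hx))
  rw [List.sum_cons, ← sub_sub, pow_succ]
  calc ufp (s - f - l.sum) ≤ unitRoundoff p ^ l.length * ufp (s - f) := h2
    _ ≤ unitRoundoff p ^ l.length * (unitRoundoff p * ufp f) :=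
      mul_le_mul_of_nonneg_left h1 (pow_nonneg u_pos.le _)
    _ = unitRoundoff p ^ l.length * unitRoundoff p * ufp f := by ring

/-- **PROPOSITION 5.6, eq. (5.13), case `f_k ∉ U`.** If `f₁, …, f_k ∈ F` is a faithful rounding of `s ∈ ℝ`
and `f_k ∉ U`, then `|s − Σ fν| < 2epsᵏ·ufp(s)` and `|s − Σ fν| < 2epsᵏ·ufp(f₁)`.
[cite: RumpOgitaOishi2009, Proposition 5.6 eq. (5.13)] -/
theorem IsKFoldFaithful.abs_sub_sum_lt_of_not_mem_U (hp : 1 ≤ p) {l : List ℚ} {s : ℚ}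
    (h : IsKFoldFaithful p emin l s) (hne : l ≠ [])
    (hU : (2 : ℚ) ^ (emin + p - 1) < |l.getLast hne|) :
    |s - l.sum| < 2 * unitRoundoff p ^ l.length * ufp s ∧
      |s - l.sum| < 2 * unitRoundoff p ^ l.length * ufp (l.head hne) := by
  have hall := h.threshold_lt_abs_of_getLast hp hne hU
  obtain ⟨f, l', rfl⟩ : ∃ f l', l = f :: l' := by
    cases l with
    | nil => exact absurd rfl hne
    | cons f l' => exact ⟨f, l', rfl⟩
  have hf : (2 : ℚ) ^ (emin + p - 1) < |f| := hall f (by simp)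
  have hf0 : f ≠ 0 := by
    rintro rfl
    rw [abs_zero] at hf
    exact absurd hf (not_lt.mpr (two_zpow_pos _).le)
  have h52 := faithful_abs_sub_lt_two_u_ufp hp h.1 hf
  have hs0 : s ≠ 0 := by
    rintro rfl
    rw [ufp_zero, mul_zero] at h52
    exact absurd h52.1 (not_lt.mpr (abs_nonneg _))
  have hb1 := h.ufp_sub_sum_le hp hall
  have hb2 := h.ufp_sub_sum_le_head hp hall
  rw [List.length_cons] at hb1
  simp only [List.length_cons, List.head_cons]
  have hpow : 0 < unitRoundoff p ^ (l'.length + 1) := pow_pos u_pos _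
  have hus := ufp_pos hs0
  have huf := ufp_pos hf0
  by_cases hz : s - (f :: l').sum = 0
  · rw [hz, abs_zero]
    exact ⟨by positivity, by positivity⟩
  · have hlt := abs_lt_two_mul_ufp hz
    constructor
    · calc |s - (f :: l').sum| < 2 * ufp (s - (f :: l').sum) := hlt
        _ ≤ 2 * (unitRoundoff p ^ (l'.length + 1) * ufp s) := by linarith
        _ = 2 * unitRoundoff p ^ (l'.length + 1) * ufp s := by ring
    · calc |s - (f :: l').sum| < 2 * ufp (s - (f :: l').sum) := hlt
        _ ≤ 2 * (unitRoundoff p ^ (l'.length + 1) * ufp f) := by linarith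
        _ = 2 * unitRoundoff p ^ (l'.length + 1) * ufp f := by ring

/-- Eq. (5.9), the "anticipated bound on the relative error with respect to `s`", delivered by Proposition 5.6
when `f_k ∉ U`: `|s − Σ fν| < 2epsᵏ|s|` (`ufp(s) ≤ |s|`). [cite: RumpOgitaOishi2009, eq. (5.9) / Proposition 5.6] -/
theorem IsKFoldFaithful.abs_sub_sum_lt_rel (hp : 1 ≤ p) {l : List ℚ} {s : ℚ}
    (h : IsKFoldFaithful p emin l s) (hne : l ≠ [])
    (hU : (2 : ℚ) ^ (emin + p - 1) < |l.getLast hne|) :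
    |s - l.sum| < 2 * unitRoundoff p ^ l.length * |s| := by
  have h1 := (h.abs_sub_sum_lt_of_not_mem_U hp hne hU).1
  have h2 := ufp_le_abs s
  have hpow : 0 < unitRoundoff p ^ l.length := pow_pos u_pos _
  calc |s - l.sum| < 2 * unitRoundoff p ^ l.length * ufp s := h1
    _ ≤ 2 * unitRoundoff p ^ l.length * |s| := mul_le_mul_of_nonneg_left h2 (by positivity)

/-- **PROPOSITION 5.6, eq. (5.13), case `f_k ∈ U`.** If `f₁, …, f_k ∈ F` is a faithful rounding of `s ∈ ℝ`
and `f_k ∈ U` (`|f_k| ≤ ½eps⁻¹eta`), then `|s − Σ fν| < eta` (Lemma 5.1, eq. (5.3), for `f_k ∈ □(Δ_{k−1})`).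
[cite: RumpOgitaOishi2009, Proposition 5.6 eq. (5.13)] -/
theorem IsKFoldFaithful.abs_sub_sum_lt_eta (hp : 1 ≤ p) {l : List ℚ} :
    ∀ {s : ℚ}, IsKFoldFaithful p emin l s → (hne : l ≠ []) →
      |l.getLast hne| ≤ (2 : ℚ) ^ (emin + p - 1) → |s - l.sum| < (2 : ℚ) ^ emin := by
  induction l with
  | nil => intro s _ hne; exact absurd rfl hne
  | cons f l ih =>
    intro s h hne hU
    cases l with
    | nil =>
      rw [List.getLast_singleton] at hU
      rw [List.sum_cons, List.sum_nil, add_zero]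
      exact faithful_abs_sub_lt_eta hp h.1 hU
    | cons g l' =>
      rw [List.getLast_cons (List.cons_ne_nil g l')] at hU
      rw [List.sum_cons, ← sub_sub]
      exact ih h.2 (List.cons_ne_nil g l') hU

/-- Proposition 5.6 with Lemma 5.1's Remark, for `s ∈ etaℤ` (e.g. `s = Σ pᵢ` a sum of floats): if `f_k ∈ U`
then `Σ fν = s` EXACTLY (`|s − Σ fν| < eta` and `s − Σ fν ∈ etaℤ`) — the form used in §6 ("`Res_k ∈ U` for
some `k` implies `Res := Σ Resν = s`", Proposition 6.5). [cite: RumpOgitaOishi2009, Proposition 5.6 / Lemma 5.1 (Remark)] -/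
theorem IsKFoldFaithful.sum_eq_of_onGrid (hp : 1 ≤ p) {l : List ℚ} {s : ℚ} (h : IsKFoldFaithful p emin l s)
    (hs : OnGrid ((2 : ℚ) ^ emin) s) (hne : l ≠ []) (hU : |l.getLast hne| ≤ (2 : ℚ) ^ (emin + p - 1)) :
    l.sum = s := by
  have hlt := h.abs_sub_sum_lt_eta hp hne hU
  have hg : OnGrid ((2 : ℚ) ^ emin) (s - l.sum) :=
    hs.sub (onGrid_list_sum fun x hx => onGrid_eta_of_isFloat (h.isFloat x hx))
  by_contra hne'
  have := two_zpow_le_abs_of_onGrid hg (sub_ne_zero.mpr (Ne.symm hne'))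
  linarith

/-- `eps ≤ ½` (`p ≥ 1`). [cite: RumpOgitaOishi2009, §2 (eps)] -/
theorem u_le_half (hp : 1 ≤ p) : unitRoundoff p ≤ 1 / 2 := by
  rw [unitRoundoff]
  have : (2 : ℚ) ≤ 2 ^ p := by
    calc (2 : ℚ) = 2 ^ 1 := by norm_num
      _ ≤ 2 ^ p := pow_le_pow_right₀ (by norm_num) hp
  exact one_div_le_one_div_of_le (by norm_num) this

/-- `eps = 2⁻ᵖ`. [cite: RumpOgitaOishi2009, §2 (eps)] -/
theorem u_eq_two_zpow_neg : unitRoundoff p = (2 : ℚ) ^ (-(p : ℤ)) := by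
  rw [unitRoundoff, zpow_neg, zpow_natCast, one_div]

/-- **PROPOSITION 5.6, "Moreover, a sequence representing a faithful rounding need not to be strongly
faithful, i.e. may be overlapping"** — the printed example `f₁ = 1 − eps`, `f₂ = eps`, `s = 1 − eps³`:
`f₁ + pred(f₂) < s < f₁ + succ(f₂)` and `pred(f₁) = 1 − 2eps < s < 1 = succ(f₁)`, so `(f₁, f₂)` is a
faithful rounding of `s`, "however, it is overlapping by `|f₂| ≥ 2eps·ufp(f₁) = eps`". Proved for every
precision `p ≥ 1` and every `emin ≤ −p` (so that `eps ∈ F`). [cite: RumpOgitaOishi2009, Proposition 5.6 (example)] -/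
theorem faithful_not_nonOverlapping_example (hp : 1 ≤ p) (hemin : emin ≤ -(p : ℤ)) :
    IsKFoldFaithful p emin [1 - unitRoundoff p, unitRoundoff p] (1 - unitRoundoff p ^ 3) ∧
      ¬ NonOverlapping p [1 - unitRoundoff p, unitRoundoff p] := by
  set u := unitRoundoff p with hu_def
  have hu0 : 0 < u := u_pos
  have hu2 : u ≤ 1 / 2 := u_le_half hp
  have hu : u = (2 : ℚ) ^ (-(p : ℤ)) := u_eq_two_zpow_neg
  have hsq : u ^ 2 ≤ u / 2 := by nlinarith
  have hcb : u ^ 3 ≤ u / 4 := by nlinarith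
  -- `f₂ = eps = 2⁻ᵖ ∈ F`, `f₁ = 1 − eps = (2ᵖ − 1)·2⁻ᵖ ∈ F`
  have hf2 : IsFloat p emin u := by
    rw [hu]
    exact isFloat_two_zpow hp hemin
  have hf1 : IsFloat p emin (1 - u) := by
    have h1p : (1 : ℤ) ≤ 2 ^ p := one_le_pow₀ (by norm_num)
    have hN : |(2 ^ p - 1 : ℤ)| ≤ 2 ^ p := by
      rw [abs_of_nonneg (by omega)]
      omega
    have hfl := isFloat_of_abs_le (emin := emin) hp hN (k := -(p : ℤ)) hemin
    have h2pu : (2 : ℚ) ^ p * u = 1 := two_pow_mul_u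
    convert hfl using 2
    rw [← hu]
    push_cast
    rw [sub_mul, one_mul, h2pu]
  -- `ufp(1 − eps) = ½`
  have habs1 : |1 - u| = 1 - u := abs_of_pos (by linarith)
  have hufp1 : ufp (1 - u) = (2 : ℚ) ^ (-1 : ℤ) := by
    apply ufp_eq_two_zpow_of_le_of_lt
    · rw [habs1]
      norm_num
      linarith
    · rw [habs1]
      norm_num
      linarith
  refine ⟨?_, ?_⟩
  · simp only [isKFoldFaithful_cons, isKFoldFaithful_nil, and_true]
    refine ⟨⟨hf1, fun g hg hlt => ?_, fun g hg hlt => ?_⟩, ⟨hf2, fun g hg hlt => ?_, fun g _ hlt => ?_⟩⟩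
    · -- floats below `1 − eps` are `≤ 1 − 2eps + eps² < 1 − eps³` (Part I, eq. (2.23))
      have h := u_mul_abs_le_abs_sub hp hf1 hg hlt.ne
      rw [habs1, abs_sub_comm, abs_of_pos (sub_pos.mpr hlt)] at h
      linarith
    · -- floats above `1 − eps` are `≥ 1 > 1 − eps³` (the grid `2⁻ᵖℤ` on `[½, 1)`)
      have hu3 : 0 < u ^ 3 := by positivity
      by_contra hle
      rw [not_lt] at hle
      have hg1 : g < 1 := by linarith
      have hgpos : 0 < g := by linarith
      have hgE : (2 : ℚ) ^ (-1 : ℤ) ≤ |g| := by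
        rw [abs_of_pos hgpos]
        norm_num
        linarith
      have hgr : OnGrid ((2 : ℚ) ^ (-(p : ℤ))) g := by
        have := onGrid_of_isFloat_of_le_abs hg hgE
        rwa [show (-1 : ℤ) - p + 1 = -(p : ℤ) by ring] at this
      have hfr : OnGrid ((2 : ℚ) ^ (-(p : ℤ))) (1 - u) := by
        have hE1 : (2 : ℚ) ^ (-1 : ℤ) ≤ |1 - u| := by
          rw [habs1]
          norm_num
          linarith
        have := onGrid_of_isFloat_of_le_abs hf1 hE1
        rwa [show (-1 : ℤ) - p + 1 = -(p : ℤ) by ring] at this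
      have hd := two_zpow_le_abs_of_onGrid (hgr.sub hfr) (sub_ne_zero.mpr hlt.ne')
      rw [← hu, abs_of_pos (sub_pos.mpr hlt)] at hd
      linarith
    · -- floats below `eps` are `≤ eps − eps² < eps − eps³`
      rcases le_or_gt g 0 with hg0 | hg0
      · linarith
      · have hlt' : |g| < (2 : ℚ) ^ (-(p : ℤ)) := by
          rw [abs_of_pos hg0, ← hu]
          exact hlt
        have h := abs_le_sub_of_abs_lt_two_zpow hp hg hlt'
        rw [abs_of_pos hg0, show (-(p : ℤ)) - p = -(p : ℤ) + -(p : ℤ) by ring,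
          zpow_add₀ (by norm_num : (2 : ℚ) ≠ 0), ← hu] at h
        have : u ^ 3 < u ^ 2 := by nlinarith
        nlinarith
    · have : 0 < u ^ 3 := by positivity
      linarith
  · -- overlapping: `|f₂| = eps = 2eps·ufp(f₁)` is not `< 2eps·ufp(f₁)`
    intro h
    rw [nonOverlapping_cons_cons] at h
    have h1 := h.1.1 (by linarith : (0 : ℚ) < 1 - u).ne'
    rw [hufp1, abs_of_pos hu0, show ((2 : ℚ) ^ (-1 : ℤ)) = 1 / 2 by norm_num] at h1
    linarith

end Literature.ComputerArithmetic.RumpOgitaOishi2009
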